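import Literature.NumberTheory.EllipticCurves.ZpCorankCyclicAction
import HarnessLib

/-!
# The `ℤ_p`-corank of a `ℤ[C_{p^n}]`-module and of its invariants have the same parity (`p` odd)

Companion of `Literature.NumberTheory.EllipticCurves.ZpCorankCyclicAction` (the case `n = 1`:
`zpCorank_mod_two_eq_of_pow_eq_id`). For a `p`-primary abelian group `A` with finite `p`-torsion,
`p` an odd prime, and an additive endomorphism `c` with `c^{p^n} = 1`,
`zpCorank A p ≡ zpCorank A^{⟨c⟩} p (mod 2)` (`zpCorank_mod_two_eq_of_pow_prime_pow_eq_id`):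
along the chain of fixed subgroups `A^{c} = A^{c^{p^0}} ⊆ A^{c^{p^1}} ⊆ ⋯ ⊆ A^{c^{p^n}} = A`
each step is the case `n = 1` for the endomorphism `c^{p^k}` of `A^{c^{p^{k+1}}}`, of order
dividing `p`, whose fixed points are `A^{c^{p^k}}`. (Representation-theoretically: the
`ℚ_p`-irreducible representations of the cyclic group of order `p^n` are the trivial one and, for
`1 ≤ k ≤ n`, one of even dimension `φ(p^k) = (p-1)p^{k-1}`.) This is the form in which
Dokchitser–Dokchitser, Ann. of Math. 172 (2010), Cor. 4.15 ("the parity of the `p^∞`-Selmer rank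
is unchanged in cyclic `p`-extensions") is iterated up a cyclic `p`-power tower, e.g. the layers
of a `ℤ_p`-extension (§4.6, proof of Thm. 4.19). Everything here is proved.

## References

* T. Dokchitser, V. Dokchitser, Ann. of Math. 172 (2010), Cor. 4.15 and §4.6.
  [DokchitserDokchitserAnnals2010]
-/

noncomputable section

open scoped AddSubgroup

open Function

namespace Literature.NumberTheory.EllipticCurves

section PrimePower

variable {A : Type*} [AddCommGroup A] {p : ℕ} [hp : Fact p.Prime]

/-- The fixed subgroup `A^F = {a | F a = a}` of an additive endomorphism. [folklore] -/
def fixedSubgroup (F : A →+ A) : AddSubgroup A where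
  carrier := {a | F a = a}
  add_mem' {a b} ha hb := by
    simp only [Set.mem_setOf_eq, map_add] at ha hb ⊢
    rw [ha, hb]
  zero_mem' := by simp
  neg_mem' {a} ha := by
    simp only [Set.mem_setOf_eq, map_neg] at ha ⊢
    rw [ha]

omit hp in
/-- Membership in the fixed subgroup. [folklore] -/
@[simp]
theorem mem_fixedSubgroup {F : A →+ A} {a : A} : a ∈ fixedSubgroup F ↔ F a = a :=
  Iff.rfl

/-- **`zpCorank A ≡ zpCorank A^{⟨c⟩} (mod 2)` for an endomorphism `c` with `c^{p^n} = 1`** of a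
`p`-primary group `A` with finite `p`-torsion, `p` odd. Induction along
`A^{c^{p^0}} ⊆ A^{c^{p^1}} ⊆ ⋯ ⊆ A^{c^{p^n}} = A`, each step being
`zpCorank_mod_two_eq_of_pow_eq_id` for `c^{p^k}` acting on `A^{c^{p^{k+1}}}`. The invariants are
any subgroup `K` with `a ∈ K ↔ c a = a`. (Dokchitser–Dokchitser 2010, Cor. 4.15, iterated:
cyclic `p`-power extensions.) [cite: DokchitserDokchitserAnnals2010, Cor. 4.15] -/
theorem zpCorank_mod_two_eq_of_pow_prime_pow_eq_id (hA : ∀ a : A, ∃ m : ℕ, p ^ m • a = 0)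
    [Finite A[(p : ℤ)]] (hp2 : p ≠ 2) (c : A →+ A) (n : ℕ)
    (hcp : ∀ a, (c.toIntLinearMap ^ (p ^ n)) a = a)
    (K : AddSubgroup A) (hK : ∀ a, a ∈ K ↔ c a = a) :
    zpCorank A p % 2 = zpCorank K p % 2 := by
  set C := c.toIntLinearMap with hC
  -- the chain of fixed subgroups `Kk k = A^{c^{p^k}}`
  let Kk : ℕ → AddSubgroup A := fun k ↦ fixedSubgroup (C ^ (p ^ k)).toAddMonoidHom
  have hmemKk : ∀ k a, a ∈ Kk k ↔ (C ^ (p ^ k)) a = a := fun k a ↦ Iff.rfl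
  have hmono : ∀ k, Kk k ≤ Kk (k + 1) := fun k a ha ↦ by
    rw [hmemKk] at ha ⊢
    rw [pow_succ, pow_mul]
    have : ∀ j : ℕ, ((C ^ p ^ k) ^ j) a = a := fun j ↦ by
      induction j with
      | zero => simp
      | succ j ih => rw [pow_succ, Module.End.mul_apply, ha, ih]
    exact this p
  -- one step: `zpCorank Kk (k+1) ≡ zpCorank Kk k (mod 2)`
  have hstep : ∀ k, zpCorank (Kk (k + 1)) p % 2 = zpCorank (Kk k) p % 2 := by
    intro k
    set D : Module.End ℤ A := C ^ (p ^ k) with hD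
    have hcomm : D * C ^ (p ^ (k + 1)) = C ^ (p ^ (k + 1)) * D := (Commute.pow_pow (Commute.refl C) _ _).eq
    have hmap : ∀ b ∈ (LinearMap.ker (C ^ (p ^ (k + 1)) - 1)), D b ∈ LinearMap.ker (C ^ (p ^ (k + 1)) - 1) := by
      intro b hb
      rw [LinearMap.mem_ker, LinearMap.sub_apply, Module.End.one_apply, sub_eq_zero] at hb ⊢
      rw [← Module.End.mul_apply, ← hcomm, Module.End.mul_apply, hb]
    -- identify `Kk (k+1)` with that kernel
    have hker : ∀ a, a ∈ LinearMap.ker (C ^ (p ^ (k + 1)) - 1) ↔ a ∈ Kk (k + 1) := fun a ↦ by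
      rw [LinearMap.mem_ker, LinearMap.sub_apply, Module.End.one_apply, sub_eq_zero, hmemKk]
    -- the endomorphism `d = D|` of `A' = Kk (k+1)`
    let A' := LinearMap.ker (C ^ (p ^ (k + 1)) - 1)
    let d : A' →+ A' := (D.restrict hmap).toAddMonoidHom
    have hA' : ∀ b : A', ∃ m : ℕ, p ^ m • b = 0 := fun b ↦ by
      obtain ⟨m, hm⟩ := hA b
      exact ⟨m, Subtype.ext (by simpa using hm)⟩
    have hmemp : ∀ x : A'[(p : ℤ)], ((x : A') : A) ∈ A[(p : ℤ)] := by
      intro x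
      have hx := congrArg Subtype.val (AddSubgroup.torsionBy.nsmul_iff.mp x.2)
      rw [AddSubgroup.torsionBy.nsmul_iff]
      simpa using hx
    haveI : Finite A'[(p : ℤ)] :=
      Finite.of_injective (fun x : A'[(p : ℤ)] ↦ (⟨_, hmemp x⟩ : A[(p : ℤ)]))
        fun x y h ↦ Subtype.ext (Subtype.ext (Subtype.mk.inj h))
    have hpow : ∀ (i : ℕ) (b : A'), (((d.toIntLinearMap ^ i) b : A') : A) = (D ^ i) (b : A) := by
      intro i
      induction i with
      | zero => intro b; simp
      | succ i ih =>
        intro b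
        rw [pow_succ, pow_succ, Module.End.mul_apply, Module.End.mul_apply, ih]
        rfl
    have hdp : ∀ b : A', (d.toIntLinearMap ^ p) b = b := fun b ↦ by
      apply Subtype.ext
      rw [hpow, hD, ← pow_mul, ← pow_succ]
      exact ((hker b).mp b.2 :) |> fun h ↦ by rwa [hmemKk] at h
    -- the invariants of `d` are `Kk k`
    let K' : AddSubgroup A' := (Kk k).comap ((LinearMap.ker (C ^ (p ^ (k + 1)) - 1)).subtype.toAddMonoidHom)
    have hK' : ∀ b : A', b ∈ K' ↔ d b = b := fun b ↦ by
      rw [AddSubgroup.mem_comap, Subtype.ext_iff]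
      exact hmemKk k b
    have h1 := zpCorank_mod_two_eq_of_pow_eq_id hA' hp2 d hdp K' hK'
    -- transport `A' ≃ Kk (k+1)` and `K' ≃ Kk k`
    have eA : A' ≃+ Kk (k + 1) :=
      { toFun := fun b ↦ ⟨b, (hker b).mp b.2⟩
        invFun := fun a ↦ ⟨a, (hker a).mpr a.2⟩
        left_inv := fun _ ↦ rfl
        right_inv := fun _ ↦ rfl
        map_add' := fun _ _ ↦ rfl }
    have eK : K' ≃+ Kk k :=
      { toFun := fun b ↦ ⟨(b : A'), b.2⟩
        invFun := fun a ↦ ⟨⟨a, (hker a).mpr (hmono k a.2)⟩, a.2⟩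
        left_inv := fun _ ↦ rfl
        right_inv := fun _ ↦ rfl
        map_add' := fun _ _ ↦ rfl }
    rw [← zpCorank_congr eA p, ← zpCorank_congr eK p]
    exact h1
  -- chain the steps
  have hchain : ∀ k, zpCorank (Kk k) p % 2 = zpCorank (Kk 0) p % 2 := by
    intro k
    induction k with
    | zero => rfl
    | succ k ih => rw [hstep, ih]
  -- the ends of the chain
  have htop : ∀ a, a ∈ Kk n := fun a ↦ (hmemKk n a).mpr (hcp a)
  have eTop : A ≃+ Kk n :=
    { toFun := fun a ↦ ⟨a, htop a⟩
      invFun := fun a ↦ a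
      left_inv := fun _ ↦ rfl
      right_inv := fun _ ↦ rfl
      map_add' := fun _ _ ↦ rfl }
  have h0 : Kk 0 = K := by
    ext a
    rw [hmemKk, hK, pow_zero, pow_one]
    rfl
  rw [zpCorank_congr eTop p, hchain n, h0]

end PrimePower

end Literature.NumberTheory.EllipticCurves
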